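import Literature.MathematicalPhysics.QuantumManyBody.PeriodicBoseGasScatteringODEProofs
import Literature.Analysis.FluidPDE.IntegratedChainRule
import Mathlib.Analysis.SpecificLimits.Normed
import Mathlib.Analysis.Normed.Group.FunctionSeries
import Mathlib.Topology.Algebra.Order.Floor
import Mathlib.Analysis.Complex.Exponential
import HarnessLib

/-!
# The radial Schrödinger equation at energy `E` as a signed Volterra equation:
# `m(r) = r + ∫₀ʳ (r - s) q(s) m(s) ds` for coefficients with `∫₀ᵀ s|q(s)| ds < ∞`

Topic `Literature/MathematicalPhysics/QuantumManyBody`, namespace `BoseGas` (provefact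
`Literature.MathematicalPhysics.QuantumManyBody.BoseGas.BastiCenatiempoSchlein2021_upperBound`, via
`…BCS2021_lhyUpperBound_dirichlet`; first file of the first-quantised input
[BastiCenatiempoSchlein2021, Lemma 2.1] = [BoccatoEtAl2019, Lemma 4.1] = [ErdosSchleinYau2006, Lemma A.1]
of Prop. 1.3: the Neumann problem `(-Δ + ½V) f_ℓ = λ_ℓ f_ℓ` on a ball). Writing `f = m(r)/r`, the
radial equation is `-m'' + ½V m = λ m`, `m(0) = 0` [BoccatoEtAl2019, App. B, (B.1)]; with
`q = ½V - λ` and the normalisation `m'(0) = 1` this is the **Volterra equation**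
`m(r) = r + ∫₀ʳ (r - s) q(s) m(s) ds`.
The tree's `PeriodicBoseGasScatteringODE*.lean` solve it for `q = ½w ≥ 0` *bounded* by a monotone
iteration in `[0, ∞]` (`radialSol`); here `q` is **signed** (`λ > 0`) and only
`∫₀ᵀ s|q(s)| ds < ∞` is assumed — the natural class for `V ∈ L³(ℝ³)` radial
(`∫₀ᵀ s V(s) ds ≤ ‖V‖₃ (∫₀ᵀ s^{1/2})^{2/3}` by Hölder), unbounded potentials included.

* `setIntegral_mul_primitive_pow`, `setIntegral_mul_exp_primitive` — the chain rule for the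
  absolutely continuous primitive `G(s) = ∫ₐˢ g`: `∫ₐʳ g Gʲ = G(r)^{j+1}/(j+1)`,
  `∫ₐʳ g e^{G} = e^{G(r)} - 1` (from `Literature.Analysis.FluidPDE.comp_mul_sub_comp_mul_eq_integral`);
* `gronwall_volterra` — **Grönwall's lemma in Volterra form** with an `L¹` kernel:
  `0 ≤ φ ≤ B`, `φ(r) ≤ δ + ∫ₐʳ g φ` on `(a, T]` imply `φ(r) ≤ δ e^{G(r)}`;
* `volterraIter`, `volterraSol` (`m`), `volterraPrim` (`A(r) = ∫₀ʳ q m = m'(r) - 1`),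
  `volterraDeriv` (`m'`) — the Picard iterates, their limit and its derivative;
* `abs_volterraIter_le`, `abs_volterraIter_succ_sub_le` — `|m_k(r)| ≤ r e^{G(r)}`,
  `|m_{k+1}(r) - m_k(r)| ≤ r G(r)^{k+1}/(k+1)!`, `G(r) = ∫₀ʳ s|q(s)| ds`;
* `continuousOn_volterraSol`, `abs_volterraSol_le`, `volterraSol_eq` (the Volterra equation),
  `volterraSol_eq_integral_prim` (`m(r) = r + ∫₀ʳ A`), `hasDerivAt_volterraSol` (`m' = 1 + A` on
  `(0, T)`), `mul_volterraDeriv_sub_volterraSol` (`r m'(r) - m(r) = ∫₀ʳ s q(s) m(s) ds`, i.e.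
  `r² f'(r) = ∫₀ʳ s m''`, [BoccatoEtAl2019, App. B]), `volterraSol_restart`
  (`m(r) = m(R) + m'(R)(r - R) + ∫_R^r (r - s) q m`);
* `volterraSol_unique` — uniqueness among continuous functions with `|m(s)| ≤ C s`;
* `abs_volterraSol_sub_volterraSol_le`, `abs_volterraDeriv_sub_volterraDeriv_le` — Lipschitz
  dependence on `q` in the norm `∫₀ᵀ s|q₁ - q₂| ds` (used for the energy dependence
  `q_E = ½V - E` and for truncations `min(V, N) → V`);
* `le_volterraSol`, `one_le_volterraDeriv` — for `q ≥ 0`: `m(r) ≥ r`, `m' ≥ 1`;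
* `volterraSol_eq_radialSol`, `volterraDeriv_eq_radialSolDeriv` — for a bounded potential
  `q = ½w` the solution is the tree's `radialSol w` [LSSY2005, (2.4)].

No named facts; the definitions are real.

## References

* [BastiCenatiempoSchlein2021] G. Basti, S. Cenatiempo, B. Schlein, *A new second-order upper bound
  for the ground state energy of dilute Bose gases*, Forum Math. Sigma 9 (2021) e74
  (arXiv:2101.06222), Lemma 2.1 and (2.4)–(2.6) (arXiv p. 6).
* [BoccatoEtAl2019] C. Boccato, C. Brennecke, S. Cenatiempo, B. Schlein, *Optimal rate for Bose–Einstein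
  condensation in the Gross–Pitaevskii regime*, Commun. Math. Phys. 376 (2020) 1311–1395, published online 2019
  (arXiv:1812.03086), Lemma 4.1 and App. B "Properties of the scattering function", (B.1)
  `-m'' + ½Vm = λm` (arXiv p. 42).
* [ErdosSchleinYau2006] L. Erdős, B. Schlein, H.-T. Yau, *Derivation of the Gross–Pitaevskii
  hierarchy for the dynamics of Bose–Einstein condensate*, Comm. Pure Appl. Math. 59 (2006)
  1659–1741 (arXiv:math-ph/0410005), App. A, Lemma A.1 (arXiv pp. 35–36).
* [LSSY2005] E. H. Lieb, R. Seiringer, J. P. Solovej, J. Yngvason, *The Mathematics of the Bose Gas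
  and its Condensation* (2005), (2.4)–(2.5).
-/

noncomputable section

open MeasureTheory Set Filter Topology
open scoped ENNReal NNReal BigOperators Nat

namespace Literature.MathematicalPhysics.QuantumManyBody.BoseGas

/-! ### The chain rule for primitives of integrable functions -/

section ChainRule

variable {a r : ℝ} {g : ℝ → ℝ}

/-- **Chain rule for the primitive**: for `g ∈ L¹(a, r]`, `G(s) = ∫ₐˢ g` and `H ∈ C¹`,
`H(G(r)) - H(0) = ∫ₐʳ H'(G(s)) g(s) ds` (`G` is absolutely continuous with `G' = g` a.e.).
[folklore] -/
theorem comp_primitive_sub_eq_setIntegral (har : a ≤ r) (hg : IntegrableOn g (Ioc a r))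
    {H : ℝ → ℝ} (hH : ContDiff ℝ 1 H) :
    H (∫ t in Ioc a r, g t) - H 0 =
      ∫ s in Ioc a r, deriv H (∫ t in Ioc a s, g t) * g s := by
  set G : ℝ → ℝ := fun s => ∫ t in Ioc a s, g t with hGdef
  have hGa : G a = 0 := by simp [hGdef]
  have hGeq : ∀ s ∈ Icc a r, G s = G a + ∫ t in a..s, g t := fun s hs => by
    rw [hGa, zero_add, intervalIntegral.integral_of_le hs.1]
  have hgi : IntervalIntegrable g volume a r :=
    (intervalIntegrable_iff_integrableOn_Ioc_of_le har).2 hg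
  have h := Literature.Analysis.FluidPDE.comp_mul_sub_comp_mul_eq_integral har hgi hGeq hH
    (η := fun _ => (1 : ℝ)) contDiff_const
  simp only [mul_one, deriv_const', mul_zero, add_zero] at h
  have hGr : G r = ∫ t in Ioc a r, g t := rfl
  rw [hGa] at h
  rw [← hGr, h, intervalIntegral.integral_of_le har]

/-- `∫ₐʳ g(s) G(s)ʲ ds = G(r)^{j+1}/(j+1)` for the primitive `G(s) = ∫ₐˢ g` of `g ∈ L¹(a, r]`.
[folklore] -/
theorem setIntegral_mul_primitive_pow (har : a ≤ r) (hg : IntegrableOn g (Ioc a r)) (j : ℕ) :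
    ∫ s in Ioc a r, g s * (∫ t in Ioc a s, g t) ^ j =
      (∫ t in Ioc a r, g t) ^ (j + 1) / (j + 1) := by
  have hH : ContDiff ℝ 1 (fun y : ℝ => y ^ (j + 1) / (j + 1)) := by fun_prop
  have h := comp_primitive_sub_eq_setIntegral har hg hH
  have hderiv : ∀ y : ℝ, deriv (fun y : ℝ => y ^ (j + 1) / (j + 1)) y = y ^ j := by
    intro y
    rw [deriv_div_const, deriv_pow_field]
    have : ((j : ℝ) + 1) ≠ 0 := by positivity
    field_simp
    push_cast
    ring
  simp only [hderiv, ne_eq, Nat.add_eq_zero_iff, one_ne_zero, and_false, not_false_eq_true,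
    zero_pow, zero_div, sub_zero] at h
  rw [h]
  refine setIntegral_congr_fun measurableSet_Ioc fun s _ => ?_
  ring

/-- `∫ₐʳ g(s) e^{G(s)} ds = e^{G(r)} - 1` for the primitive `G(s) = ∫ₐˢ g` of `g ∈ L¹(a, r]`.
[folklore] -/
theorem setIntegral_mul_exp_primitive (har : a ≤ r) (hg : IntegrableOn g (Ioc a r)) :
    ∫ s in Ioc a r, g s * Real.exp (∫ t in Ioc a s, g t) =
      Real.exp (∫ t in Ioc a r, g t) - 1 := by
  have h := comp_primitive_sub_eq_setIntegral har hg Real.contDiff_exp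
  simp only [Real.deriv_exp, Real.exp_zero] at h
  rw [h]
  refine setIntegral_congr_fun measurableSet_Ioc fun s _ => ?_
  ring

/-- The primitive of an integrable function is continuous on `[a, T]`. [folklore] -/
theorem continuousOn_primitive_Ioc {T : ℝ} (hg : IntegrableOn g (Ioc a T)) :
    ContinuousOn (fun s => ∫ t in Ioc a s, g t) (Icc a T) := by
  have h : IntegrableOn g (Icc a T) :=
    (integrableOn_Icc_iff_integrableOn_Ioc (f := g) (μ := volume) (a := a) (b := T)).2 hg
  exact intervalIntegral.continuousOn_primitive h

/-- The primitive of a non-negative function is non-negative. [folklore] -/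
theorem setIntegral_Ioc_nonneg_of_nonneg (hg0 : ∀ s, 0 ≤ g s) (s : ℝ) : 0 ≤ ∫ t in Ioc a s, g t :=
  setIntegral_nonneg measurableSet_Ioc fun t _ => hg0 t

/-- The primitive of a non-negative integrable function is monotone on `[a, T]`. [folklore] -/
theorem setIntegral_Ioc_mono_right {T : ℝ} (hg : IntegrableOn g (Ioc a T)) (hg0 : ∀ s, 0 ≤ g s) {s₁ s₂ : ℝ}
    (h12 : s₁ ≤ s₂) (h2 : s₂ ≤ T) :
    ∫ t in Ioc a s₁, g t ≤ ∫ t in Ioc a s₂, g t :=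
  setIntegral_mono_set (hg.mono_set (Ioc_subset_Ioc_right h2))
    (ae_of_all _ fun t => hg0 t) (ae_of_all _ (Ioc_subset_Ioc_right h12))

end ChainRule

/-! ### Grönwall's lemma in Volterra form with an `L¹` kernel -/

section Gronwall

variable {a T : ℝ} {g ψ : ℝ → ℝ}

/-- `(j!)⁻¹ · x^{j+1}/(j+1) = x^{j+1}/(j+1)!`. [folklore] -/
theorem inv_factorial_mul_pow_div (x : ℝ) (j : ℕ) :
    (j ! : ℝ)⁻¹ * (x ^ (j + 1) / (j + 1)) = x ^ (j + 1) / (j + 1)! := by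
  rw [Nat.factorial_succ]
  push_cast
  have h1 : (j ! : ℝ) ≠ 0 := by positivity
  have h2 : ((j : ℝ) + 1) ≠ 0 := by positivity
  field_simp

/-- The iterated Grönwall bound: under the hypotheses of `gronwall_volterra`,
`ψ(r) ≤ δ ∑_{i ≤ k} G(r)ⁱ/i! + B G(r)^{k+1}/(k+1)!` for every `k`. [folklore] -/
theorem gronwall_volterra_iterate {δ B : ℝ} (hg : IntegrableOn g (Ioc a T)) (hg0 : ∀ s, 0 ≤ g s)
    (hψm : AEStronglyMeasurable ψ (volume.restrict (Ioc a T)))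
    (hψ0 : ∀ r ∈ Ioc a T, 0 ≤ ψ r) (hψB : ∀ r ∈ Ioc a T, ψ r ≤ B)
    (h : ∀ r ∈ Ioc a T, ψ r ≤ δ + ∫ s in Ioc a r, g s * ψ s) (k : ℕ) :
    ∀ r ∈ Ioc a T, ψ r ≤ δ * ∑ i ∈ Finset.range (k + 1), (∫ t in Ioc a r, g t) ^ i / i ! +
      B * ((∫ t in Ioc a r, g t) ^ (k + 1) / (k + 1)!) := by
  set G : ℝ → ℝ := fun s => ∫ t in Ioc a s, g t with hGdef
  have hG0 : ∀ s, 0 ≤ G s := fun s => setIntegral_Ioc_nonneg_of_nonneg hg0 s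
  have hGc : ContinuousOn G (Icc a T) := continuousOn_primitive_Ioc hg
  -- integrability of `g ψ` and of `g · Gʲ` on `(a, r]`
  have hgψ : ∀ r ∈ Ioc a T, IntegrableOn (fun s => g s * ψ s) (Ioc a r) := by
    intro r hr
    have hsub : Ioc a r ⊆ Ioc a T := Ioc_subset_Ioc_right hr.2
    have h1 : IntegrableOn (fun s => ψ s * g s) (Ioc a r) := by
      refine Integrable.bdd_mul (c := B) (hg.mono_set hsub) (hψm.mono_set hsub) ?_
      filter_upwards [ae_restrict_mem measurableSet_Ioc] with s hs
      rw [Real.norm_eq_abs, abs_of_nonneg (hψ0 s (hsub hs))]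
      exact hψB s (hsub hs)
    exact h1.congr (ae_of_all _ fun s => mul_comm _ _)
  have hgG : ∀ r ∈ Ioc a T, ∀ j : ℕ, IntegrableOn (fun s => g s * G s ^ j) (Ioc a r) := by
    intro r hr j
    have hsub : Ioc a r ⊆ Ioc a T := Ioc_subset_Ioc_right hr.2
    have hcont : ContinuousOn (fun s => G s ^ j) (Icc a T) := hGc.pow j
    obtain ⟨C, hC⟩ := (isCompact_Icc.image_of_continuousOn hcont).isBounded.exists_norm_le
    have h1 : IntegrableOn (fun s => G s ^ j * g s) (Ioc a r) := by
      refine Integrable.bdd_mul (c := C) (hg.mono_set hsub) ?_ ?_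
      · exact (hcont.mono (hsub.trans Ioc_subset_Icc_self)).aestronglyMeasurable measurableSet_Ioc
      · filter_upwards [ae_restrict_mem measurableSet_Ioc] with s hs
        exact hC _ (mem_image_of_mem _ (Ioc_subset_Icc_self (hsub hs)))
    exact h1.congr (ae_of_all _ fun s => mul_comm _ _)
  induction k with
  | zero =>
    intro r hr
    have hsub : Ioc a r ⊆ Ioc a T := Ioc_subset_Ioc_right hr.2
    have h1 : ∫ s in Ioc a r, g s * ψ s ≤ ∫ s in Ioc a r, g s * B := by
      refine setIntegral_mono_on (hgψ r hr) ((hg.mono_set hsub).mul_const B) measurableSet_Ioc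
        fun s hs => ?_
      exact mul_le_mul_of_nonneg_left (hψB s (hsub hs)) (hg0 s)
    rw [integral_mul_const] at h1
    have h2 := h r hr
    simp only [zero_add, Finset.range_one, Finset.sum_singleton, pow_zero, Nat.factorial_zero,
      Nat.cast_one, div_one, mul_one, Nat.factorial_one, pow_one]
    linarith [mul_comm (∫ s in Ioc a r, g s) B]
  | succ k ih =>
    intro r hr
    have hsub : Ioc a r ⊆ Ioc a T := Ioc_subset_Ioc_right hr.2
    have har : a ≤ r := hr.1.le
    -- the bound of the induction hypothesis, as a function of `s`, multiplied by `g`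
    set P : ℝ → ℝ := fun s => δ * ∑ i ∈ Finset.range (k + 1), G s ^ i / i ! +
      B * (G s ^ (k + 1) / (k + 1)!) with hPdef
    have hgP : ∀ s, g s * P s = δ * ∑ i ∈ Finset.range (k + 1), (i ! : ℝ)⁻¹ * (g s * G s ^ i) +
        B * (((k + 1)! : ℝ)⁻¹ * (g s * G s ^ (k + 1))) := by
      intro s
      simp only [hPdef]
      rw [mul_add, mul_left_comm, Finset.mul_sum, mul_left_comm (g s) B]
      congr 1
      · congr 1
        refine Finset.sum_congr rfl fun i _ => ?_
        ring
      · ring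
    have hint1 : IntegrableOn (fun s => δ * ∑ i ∈ Finset.range (k + 1), (i ! : ℝ)⁻¹ * (g s * G s ^ i))
        (Ioc a r) :=
      Integrable.const_mul (integrable_finsetSum _ fun i _ => (hgG r hr i).const_mul _) _
    have hint2 : IntegrableOn (fun s => B * (((k + 1)! : ℝ)⁻¹ * (g s * G s ^ (k + 1)))) (Ioc a r) :=
      Integrable.const_mul (Integrable.const_mul (hgG r hr (k + 1)) _) _
    have hPint : IntegrableOn (fun s => g s * P s) (Ioc a r) := by
      rw [show (fun s => g s * P s) = _ from funext hgP]
      exact hint1.add hint2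
    have h1 : ∫ s in Ioc a r, g s * ψ s ≤ ∫ s in Ioc a r, g s * P s := by
      refine setIntegral_mono_on (hgψ r hr) hPint measurableSet_Ioc fun s hs => ?_
      exact mul_le_mul_of_nonneg_left (ih s (hsub hs)) (hg0 s)
    -- evaluate `∫ g P` by the chain rule
    have hpow : ∀ j : ℕ, ∫ s in Ioc a r, g s * G s ^ j = G r ^ (j + 1) / (j + 1) := fun j =>
      setIntegral_mul_primitive_pow har (hg.mono_set hsub) j
    have h2 : ∫ s in Ioc a r, g s * P s = δ * ∑ i ∈ Finset.range (k + 1), G r ^ (i + 1) / (i + 1)! +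
        B * (G r ^ (k + 2) / (k + 2)!) := by
      rw [show (fun s => g s * P s) = _ from funext hgP, integral_add hint1 hint2, integral_const_mul,
        integral_const_mul, integral_const_mul, integral_finsetSum _ fun i _ => (hgG r hr i).const_mul _]
      simp only [integral_const_mul, hpow, inv_factorial_mul_pow_div]
    have h4 := h r hr
    -- reindex `δ + δ ∑_{i<k+1} G^{i+1}/(i+1)! = δ ∑_{i<k+2} G^i/i!`
    have h5 : δ + δ * ∑ i ∈ Finset.range (k + 1), G r ^ (i + 1) / (i + 1)! =
        δ * ∑ i ∈ Finset.range (k + 1 + 1), G r ^ i / i ! := by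
      rw [Finset.sum_range_succ' (fun i => G r ^ i / (i ! : ℝ))]
      simp only [pow_zero, Nat.factorial_zero, Nat.cast_one, div_one]
      ring
    calc ψ r ≤ δ + ∫ s in Ioc a r, g s * ψ s := h4
      _ ≤ δ + ∫ s in Ioc a r, g s * P s := by linarith
      _ = δ * ∑ i ∈ Finset.range (k + 1 + 1), G r ^ i / i ! + B * (G r ^ (k + 1 + 1) / (k + 1 + 1)!) := by
          rw [h2, ← h5, show k + 1 + 1 = k + 2 from rfl]; ring

/-- **Grönwall's lemma in Volterra form.** Let `g ≥ 0` be integrable on `(a, T]`,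
`G(r) = ∫ₐʳ g`, and let `ψ` be measurable on `(a, T]` with `0 ≤ ψ ≤ B` and
`ψ(r) ≤ δ + ∫ₐʳ g(s) ψ(s) ds` for all `r ∈ (a, T]`. Then `ψ(r) ≤ δ e^{G(r)}` on `(a, T]`.
(Iterate the inequality: `ψ ≤ δ ∑_{i≤k} Gⁱ/i! + B G^{k+1}/(k+1)!`, and let `k → ∞`.)
[folklore] -/
theorem gronwall_volterra {δ B : ℝ} (hg : IntegrableOn g (Ioc a T)) (hg0 : ∀ s, 0 ≤ g s)
    (hψm : AEStronglyMeasurable ψ (volume.restrict (Ioc a T)))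
    (hψ0 : ∀ r ∈ Ioc a T, 0 ≤ ψ r) (hψB : ∀ r ∈ Ioc a T, ψ r ≤ B) (hδ : 0 ≤ δ)
    (h : ∀ r ∈ Ioc a T, ψ r ≤ δ + ∫ s in Ioc a r, g s * ψ s) :
    ∀ r ∈ Ioc a T, ψ r ≤ δ * Real.exp (∫ t in Ioc a r, g t) := by
  intro r hr
  set x : ℝ := ∫ t in Ioc a r, g t with hx
  have hx0 : 0 ≤ x := setIntegral_Ioc_nonneg_of_nonneg hg0 r
  have hB0 : 0 ≤ B := (hψ0 r hr).trans (hψB r hr)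
  have hk : ∀ k : ℕ, ψ r ≤ δ * Real.exp x + B * (x ^ (k + 1) / (k + 1)!) := by
    intro k
    have h1 := gronwall_volterra_iterate hg hg0 hψm hψ0 hψB h k r hr
    have h2 : ∑ i ∈ Finset.range (k + 1), x ^ i / i ! ≤ Real.exp x := Real.sum_le_exp_of_nonneg hx0 _
    have h3 : δ * ∑ i ∈ Finset.range (k + 1), x ^ i / i ! ≤ δ * Real.exp x :=
      mul_le_mul_of_nonneg_left h2 hδ
    linarith
  -- `x^{k+1}/(k+1)! → 0`
  have hlim : Tendsto (fun k : ℕ => δ * Real.exp x + B * (x ^ (k + 1) / (k + 1)!)) atTop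
      (𝓝 (δ * Real.exp x + B * 0)) := by
    have h1 : Tendsto (fun k : ℕ => x ^ k / k !) atTop (𝓝 0) := FloorSemiring.tendsto_pow_div_factorial_atTop x
    have h2 : Tendsto (fun k : ℕ => x ^ (k + 1) / (k + 1)!) atTop (𝓝 0) :=
      h1.comp (tendsto_add_atTop_nat 1)
    exact tendsto_const_nhds.add (h2.const_mul B)
  rw [mul_zero, add_zero] at hlim
  exact ge_of_tendsto' hlim hk

end Gronwall

/-! ### Integrability toolkit for coefficients with `∫₀ᵀ s|q(s)| ds < ∞` and functions of linear growth -/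

section LinGrowth

variable {q m : ℝ → ℝ} {T C : ℝ}

/-- The weight `g(s) = s|q(s)|` is integrable on `(0, T]` when `s q(s)` is. [folklore] -/
theorem integrableOn_mul_abs (hI : IntegrableOn (fun s => s * q s) (Ioc 0 T)) :
    IntegrableOn (fun s => s * |q s|) (Ioc 0 T) := by
  refine (hI.norm).congr ?_
  filter_upwards [ae_restrict_mem measurableSet_Ioc] with s hs
  rw [Real.norm_eq_abs, abs_mul, abs_of_pos hs.1]

/-- `0 ≤ s|q(s)|` on `(0, T]`-relevant points; globally after taking the positive part of `s`:
we use the weight `g(s) = max s 0 · |q s|`, which is non-negative everywhere and agrees with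
`s|q(s)|` on `(0, ∞)`. [folklore] -/
theorem posPart_mul_abs_nonneg (q : ℝ → ℝ) (s : ℝ) : 0 ≤ max s 0 * |q s| :=
  mul_nonneg (le_max_right _ _) (abs_nonneg _)

/-- The weight `max s 0 · |q(s)|` is integrable on `(0, T]`. [folklore] -/
theorem integrableOn_posPart_mul_abs (hI : IntegrableOn (fun s => s * q s) (Ioc 0 T)) :
    IntegrableOn (fun s => max s 0 * |q s|) (Ioc 0 T) := by
  refine (integrableOn_mul_abs hI).congr ?_
  filter_upwards [ae_restrict_mem measurableSet_Ioc] with s hs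
  rw [max_eq_left hs.1.le]

/-- On `(0, r]` the weight is `s|q(s)|`. [folklore] -/
theorem setIntegral_posPart_mul_abs (q : ℝ → ℝ) (r : ℝ) :
    ∫ s in Ioc 0 r, max s 0 * |q s| = ∫ s in Ioc 0 r, s * |q s| := by
  refine setIntegral_congr_fun measurableSet_Ioc fun s hs => ?_
  rw [max_eq_left hs.1.le]

/-- **`q m` is integrable** on `(0, T]` if `m` is continuous on `[0, T]` with `|m(s)| ≤ C s`:
`q m = (m/s)·(s q)` with a bounded first factor. [folklore] -/
theorem integrableOn_coeff_mul (hI : IntegrableOn (fun s => s * q s) (Ioc 0 T))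
    (hmc : ContinuousOn m (Icc 0 T)) (hmb : ∀ s ∈ Icc 0 T, |m s| ≤ C * s) :
    IntegrableOn (fun s => q s * m s) (Ioc 0 T) := by
  have hC : ∀ s ∈ Ioc 0 T, |m s / s| ≤ max C 0 := fun s hs => by
    rw [abs_div, abs_of_pos hs.1, div_le_iff₀ hs.1]
    exact (hmb s (Ioc_subset_Icc_self hs)).trans (mul_le_mul_of_nonneg_right (le_max_left _ _) hs.1.le)
  have hmeas : AEStronglyMeasurable (fun s => m s / s) (volume.restrict (Ioc 0 T)) := by
    refine ContinuousOn.aestronglyMeasurable ?_ measurableSet_Ioc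
    exact (hmc.mono Ioc_subset_Icc_self).div continuousOn_id fun s hs => hs.1.ne'
  have h1 : IntegrableOn (fun s => m s / s * (s * q s)) (Ioc 0 T) := by
    refine Integrable.bdd_mul (c := max C 0) hI hmeas ?_
    filter_upwards [ae_restrict_mem measurableSet_Ioc] with s hs
    rw [Real.norm_eq_abs]
    exact hC s hs
  refine h1.congr ?_
  filter_upwards [ae_restrict_mem measurableSet_Ioc] with s hs
  field_simp [hs.1.ne']

/-- `s q(s) m(s)` is integrable on `(0, T]` under the same hypotheses. [folklore] -/
theorem integrableOn_id_mul_coeff_mul (hI : IntegrableOn (fun s => s * q s) (Ioc 0 T))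
    (hmc : ContinuousOn m (Icc 0 T)) (hmb : ∀ s ∈ Icc 0 T, |m s| ≤ C * s) :
    IntegrableOn (fun s => s * (q s * m s)) (Ioc 0 T) := by
  refine Integrable.bdd_mul (c := max T 0) (integrableOn_coeff_mul hI hmc hmb)
    (continuousOn_id.aestronglyMeasurable measurableSet_Ioc) ?_
  filter_upwards [ae_restrict_mem measurableSet_Ioc] with s hs
  rw [Real.norm_eq_abs, abs_of_pos hs.1]
  exact hs.2.trans (le_max_left _ _)

/-- `(r - s) q(s) m(s)` is integrable on `(0, r]` for `r ≤ T`. [folklore] -/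
theorem integrableOn_kernel_mul (hI : IntegrableOn (fun s => s * q s) (Ioc 0 T))
    (hmc : ContinuousOn m (Icc 0 T)) (hmb : ∀ s ∈ Icc 0 T, |m s| ≤ C * s) {r : ℝ} (hr : r ≤ T) :
    IntegrableOn (fun s => (r - s) * q s * m s) (Ioc 0 r) := by
  have hsub : Ioc 0 r ⊆ Ioc 0 T := Ioc_subset_Ioc_right hr
  have h1 := ((integrableOn_coeff_mul hI hmc hmb).mono_set hsub).const_mul r
  have h2 := (integrableOn_id_mul_coeff_mul hI hmc hmb).mono_set hsub
  refine (h1.sub h2).congr (ae_of_all _ fun s => ?_)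
  simp only [Pi.sub_apply]
  ring

/-- `∫₀ʳ (r - s) q m = r ∫₀ʳ q m - ∫₀ʳ s q m`. [folklore] -/
theorem setIntegral_kernel_mul_eq (hI : IntegrableOn (fun s => s * q s) (Ioc 0 T))
    (hmc : ContinuousOn m (Icc 0 T)) (hmb : ∀ s ∈ Icc 0 T, |m s| ≤ C * s) {r : ℝ} (hr : r ≤ T) :
    ∫ s in Ioc 0 r, (r - s) * q s * m s =
      r * (∫ s in Ioc 0 r, q s * m s) - ∫ s in Ioc 0 r, s * (q s * m s) := by
  have hsub : Ioc 0 r ⊆ Ioc 0 T := Ioc_subset_Ioc_right hr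
  have h1 := ((integrableOn_coeff_mul hI hmc hmb).mono_set hsub).const_mul r
  have h2 := (integrableOn_id_mul_coeff_mul hI hmc hmb).mono_set hsub
  rw [← integral_const_mul, ← integral_sub h1 h2]
  refine setIntegral_congr_fun measurableSet_Ioc fun s _ => ?_
  ring

/-- `r ↦ ∫₀ʳ (r - s) q(s) m(s) ds` is continuous on `[0, T]`. [folklore] -/
theorem continuousOn_setIntegral_kernel_mul (hI : IntegrableOn (fun s => s * q s) (Ioc 0 T))
    (hmc : ContinuousOn m (Icc 0 T)) (hmb : ∀ s ∈ Icc 0 T, |m s| ≤ C * s) :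
    ContinuousOn (fun r => ∫ s in Ioc 0 r, (r - s) * q s * m s) (Icc 0 T) := by
  have h1 : ContinuousOn (fun r => r * (∫ s in Ioc 0 r, q s * m s) - ∫ s in Ioc 0 r, s * (q s * m s))
      (Icc 0 T) :=
    (continuousOn_id.mul (continuousOn_primitive_Ioc (integrableOn_coeff_mul hI hmc hmb))).sub
      (continuousOn_primitive_Ioc (integrableOn_id_mul_coeff_mul hI hmc hmb))
  exact h1.congr fun r hr => setIntegral_kernel_mul_eq hI hmc hmb hr.2

/-- **The basic estimate** `|∫₀ʳ (r - s) q m| ≤ r ∫₀ʳ s|q(s)| B(s) ds` when `|m(s)| ≤ s B(s)` with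
`B` continuous and non-negative on `[0, T]`. [folklore] -/
theorem abs_setIntegral_kernel_mul_le (hI : IntegrableOn (fun s => s * q s) (Ioc 0 T))
    {B : ℝ → ℝ} (hBc : ContinuousOn B (Icc 0 T)) (hB : ∀ s ∈ Ioc 0 T, |m s| ≤ s * B s)
    {r : ℝ} (hr : r ∈ Icc 0 T) :
    |∫ s in Ioc 0 r, (r - s) * q s * m s| ≤ r * ∫ s in Ioc 0 r, s * |q s| * B s := by
  have hsub : Ioc 0 r ⊆ Ioc 0 T := Ioc_subset_Ioc_right hr.2
  -- the majorant is integrable: `B` is bounded and measurable on `[0, T]`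
  obtain ⟨K, hK⟩ := (isCompact_Icc.image_of_continuousOn hBc).isBounded.exists_norm_le
  have hmaj : IntegrableOn (fun s => s * |q s| * B s) (Ioc 0 T) := by
    have h1 : IntegrableOn (fun s => B s * (s * |q s|)) (Ioc 0 T) := by
      refine Integrable.bdd_mul (c := K) (integrableOn_mul_abs hI)
        ((hBc.mono Ioc_subset_Icc_self).aestronglyMeasurable measurableSet_Ioc) ?_
      filter_upwards [ae_restrict_mem measurableSet_Ioc] with s hs
      exact hK _ (mem_image_of_mem _ (Ioc_subset_Icc_self hs))
    exact h1.congr (ae_of_all _ fun s => by ring)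
  have h1 : |∫ s in Ioc 0 r, (r - s) * q s * m s| ≤ ∫ s in Ioc 0 r, r * (s * |q s| * B s) := by
    rw [← Real.norm_eq_abs]
    refine norm_integral_le_of_norm_le ((hmaj.mono_set hsub).const_mul r) ?_
    filter_upwards [ae_restrict_mem measurableSet_Ioc] with s hs
    rw [Real.norm_eq_abs, abs_mul, abs_mul]
    have h2 : |r - s| ≤ r := by rw [abs_of_nonneg (by linarith [hs.2])]; linarith [hs.1]
    have h3 := hB s (hsub hs)
    have h4 : 0 ≤ r * |q s| := mul_nonneg (hs.1.le.trans hs.2) (abs_nonneg _)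
    calc |r - s| * |q s| * |m s| ≤ r * |q s| * (s * B s) := by gcongr
      _ = r * (s * |q s| * B s) := by ring
  rwa [integral_const_mul] at h1

end LinGrowth

/-! ### The Volterra iteration and its limit -/

section Volterra

/-- The **Picard iterates** of `m(r) = r + ∫₀ʳ (r - s) q(s) m(s) ds`:
`m₀(r) = r`, `m_{k+1}(r) = r + ∫₀ʳ (r - s) q(s) m_k(s) ds`. [cite: LSSY2005, (2.4)–(2.5)] -/
def volterraIter (q : ℝ → ℝ) : ℕ → ℝ → ℝ
  | 0 => fun r => r
  | k + 1 => fun r => r + ∫ s in Ioc 0 r, (r - s) * q s * volterraIter q k s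

/-- The **regular solution** `m = lim_k m_k = r + ∑_k (m_{k+1} - m_k)` of
`m(r) = r + ∫₀ʳ (r - s) q(s) m(s) ds` (`m'' = q m`, `m(0) = 0`, `m'(0) = 1`); for `q = ½V - λ` and
`f = m/r` this is the regular radial solution of `(-Δ + ½V) f = λ f`.
[cite: BoccatoEtAl2019, App. B, (B.1)] -/
def volterraSol (q : ℝ → ℝ) (r : ℝ) : ℝ :=
  r + ∑' k, (volterraIter q (k + 1) r - volterraIter q k r)

/-- `A(r) = ∫₀ʳ q(s) m(s) ds` (`= m'(r) - 1`). [cite: BoccatoEtAl2019, App. B, (B.1)] -/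
def volterraPrim (q : ℝ → ℝ) (r : ℝ) : ℝ :=
  ∫ s in Ioc 0 r, q s * volterraSol q s

/-- The derivative `m'(r) = 1 + ∫₀ʳ q(s) m(s) ds` of the regular solution.
[cite: BoccatoEtAl2019, App. B, (B.1)] -/
def volterraDeriv (q : ℝ → ℝ) (r : ℝ) : ℝ :=
  1 + volterraPrim q r

/-- The weight `G(r) = ∫₀ʳ s|q(s)| ds` controlling the iteration. [folklore] -/
def volterraWeight (q : ℝ → ℝ) (r : ℝ) : ℝ :=
  ∫ s in Ioc 0 r, max s 0 * |q s|

variable {q : ℝ → ℝ} {T : ℝ}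

/-- `m₀(r) = r`. [folklore] -/
@[simp] theorem volterraIter_zero (q : ℝ → ℝ) (r : ℝ) : volterraIter q 0 r = r := rfl

/-- `m_{k+1}(r) = r + ∫₀ʳ (r - s) q m_k`. [folklore] -/
theorem volterraIter_succ (q : ℝ → ℝ) (k : ℕ) (r : ℝ) :
    volterraIter q (k + 1) r = r + ∫ s in Ioc 0 r, (r - s) * q s * volterraIter q k s := rfl

/-- `G(r) = ∫₀ʳ s|q(s)| ds`. [folklore] -/
theorem volterraWeight_eq (q : ℝ → ℝ) (r : ℝ) : volterraWeight q r = ∫ s in Ioc 0 r, s * |q s| :=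
  setIntegral_posPart_mul_abs q r

/-- `G ≥ 0`. [folklore] -/
theorem volterraWeight_nonneg (q : ℝ → ℝ) (r : ℝ) : 0 ≤ volterraWeight q r :=
  setIntegral_Ioc_nonneg_of_nonneg (posPart_mul_abs_nonneg q) r

/-- `G` is monotone on `[0, T]`. [folklore] -/
theorem volterraWeight_mono (hI : IntegrableOn (fun s => s * q s) (Ioc 0 T)) {s₁ s₂ : ℝ}
    (h12 : s₁ ≤ s₂) (h2 : s₂ ≤ T) : volterraWeight q s₁ ≤ volterraWeight q s₂ :=
  setIntegral_Ioc_mono_right (integrableOn_posPart_mul_abs hI) (posPart_mul_abs_nonneg q) h12 h2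

/-- `G` is continuous on `[0, T]`. [folklore] -/
theorem continuousOn_volterraWeight (hI : IntegrableOn (fun s => s * q s) (Ioc 0 T)) :
    ContinuousOn (volterraWeight q) (Icc 0 T) :=
  continuousOn_primitive_Ioc (integrableOn_posPart_mul_abs hI)

/-- At `r = 0` every iterate vanishes. [folklore] -/
theorem volterraIter_apply_zero (q : ℝ → ℝ) : ∀ k, volterraIter q k 0 = 0
  | 0 => rfl
  | k + 1 => by rw [volterraIter_succ, Ioc_self, Measure.restrict_empty, integral_zero_measure, add_zero]

/-- **A priori bound and continuity of the iterates**: `m_k` is continuous on `[0, T]` and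
`|m_k(r)| ≤ r e^{G(r)}` (`r e^{G(r)}` is a supersolution of the Volterra inequality).
[cite: LSSY2005, (2.4)] -/
theorem volterraIter_continuousOn_and_bound (hI : IntegrableOn (fun s => s * q s) (Ioc 0 T)) :
    ∀ k, ContinuousOn (volterraIter q k) (Icc 0 T) ∧
      ∀ r ∈ Icc 0 T, |volterraIter q k r| ≤ r * Real.exp (volterraWeight q r)
  | 0 => by
      refine ⟨continuousOn_id, fun r hr => ?_⟩
      rw [volterraIter_zero, abs_of_nonneg hr.1]
      exact le_mul_of_one_le_right hr.1 (Real.one_le_exp (volterraWeight_nonneg q r))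
  | k + 1 => by
      obtain ⟨hc, hb⟩ := volterraIter_continuousOn_and_bound hI k
      have hET : ∀ s ∈ Icc 0 T, |volterraIter q k s| ≤ Real.exp (volterraWeight q T) * s := by
        intro s hs
        refine (hb s hs).trans ?_
        rw [mul_comm]
        exact mul_le_mul_of_nonneg_right (Real.exp_le_exp.2 (volterraWeight_mono hI hs.2 le_rfl)) hs.1
      refine ⟨?_, fun r hr => ?_⟩
      · have h1 := continuousOn_setIntegral_kernel_mul hI hc hET
        exact (continuousOn_id.add h1).congr fun r _ => volterraIter_succ q k r
      · have hBc : ContinuousOn (fun s => Real.exp (volterraWeight q s)) (Icc 0 T) :=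
          (continuousOn_volterraWeight hI).rexp
        have h1 := abs_setIntegral_kernel_mul_le hI hBc (fun s hs => hb s (Ioc_subset_Icc_self hs)) hr
        have h2 : ∫ s in Ioc 0 r, s * |q s| * Real.exp (volterraWeight q s) =
            Real.exp (volterraWeight q r) - 1 := by
          have h3 := setIntegral_mul_exp_primitive hr.1 ((integrableOn_posPart_mul_abs hI).mono_set
            (Ioc_subset_Ioc_right hr.2))
          have h4 : volterraWeight q r = ∫ t in Ioc 0 r, max t 0 * |q t| := rfl
          rw [h4, ← h3]
          refine setIntegral_congr_fun measurableSet_Ioc fun s hs => ?_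
          simp only [volterraWeight, max_eq_left hs.1.le]
        rw [h2] at h1
        rw [volterraIter_succ]
        calc |r + ∫ s in Ioc 0 r, (r - s) * q s * volterraIter q k s|
            ≤ |r| + |∫ s in Ioc 0 r, (r - s) * q s * volterraIter q k s| := abs_add_le _ _
          _ ≤ r + r * (Real.exp (volterraWeight q r) - 1) := by rw [abs_of_nonneg hr.1]; gcongr
          _ = r * Real.exp (volterraWeight q r) := by ring

/-- The iterates are continuous on `[0, T]`. [folklore] -/
theorem continuousOn_volterraIter (hI : IntegrableOn (fun s => s * q s) (Ioc 0 T)) (k : ℕ) :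
    ContinuousOn (volterraIter q k) (Icc 0 T) :=
  (volterraIter_continuousOn_and_bound hI k).1

/-- `|m_k(r)| ≤ r e^{G(r)}` on `[0, T]`. [cite: LSSY2005, (2.4)] -/
theorem abs_volterraIter_le (hI : IntegrableOn (fun s => s * q s) (Ioc 0 T)) (k : ℕ) {r : ℝ}
    (hr : r ∈ Icc 0 T) : |volterraIter q k r| ≤ r * Real.exp (volterraWeight q r) :=
  (volterraIter_continuousOn_and_bound hI k).2 r hr

/-- The uniform linear-growth bound `|m_k(s)| ≤ e^{G(T)} s` on `[0, T]`. [folklore] -/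
theorem abs_volterraIter_le_mul (hI : IntegrableOn (fun s => s * q s) (Ioc 0 T)) (k : ℕ) {s : ℝ}
    (hs : s ∈ Icc 0 T) : |volterraIter q k s| ≤ Real.exp (volterraWeight q T) * s := by
  refine (abs_volterraIter_le hI k hs).trans ?_
  rw [mul_comm]
  exact mul_le_mul_of_nonneg_right (Real.exp_le_exp.2 (volterraWeight_mono hI hs.2 le_rfl)) hs.1

/-- The difference of consecutive iterates is the kernel applied to the previous difference:
`m_{k+2} - m_{k+1} = ∫₀ʳ (r - s) q (m_{k+1} - m_k)`. [folklore] -/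
theorem volterraIter_succ_sub (hI : IntegrableOn (fun s => s * q s) (Ioc 0 T)) (k : ℕ) {r : ℝ}
    (hr : r ∈ Icc 0 T) :
    volterraIter q (k + 2) r - volterraIter q (k + 1) r =
      ∫ s in Ioc 0 r, (r - s) * q s * (volterraIter q (k + 1) s - volterraIter q k s) := by
  rw [volterraIter_succ q (k + 1), volterraIter_succ q k, add_sub_add_left_eq_sub,
    ← integral_sub (integrableOn_kernel_mul hI (continuousOn_volterraIter hI (k + 1))
      (fun s hs => abs_volterraIter_le_mul hI (k + 1) hs) hr.2)
      (integrableOn_kernel_mul hI (continuousOn_volterraIter hI k)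
      (fun s hs => abs_volterraIter_le_mul hI k hs) hr.2)]
  refine setIntegral_congr_fun measurableSet_Ioc fun s _ => ?_
  ring

/-- **Convergence rate of the iteration**: `|m_{k+1}(r) - m_k(r)| ≤ r G(r)^{k+1}/(k+1)!`.
[folklore] -/
theorem abs_volterraIter_succ_sub_le (hI : IntegrableOn (fun s => s * q s) (Ioc 0 T)) :
    ∀ (k : ℕ) {r : ℝ}, r ∈ Icc 0 T →
      |volterraIter q (k + 1) r - volterraIter q k r| ≤ r * (volterraWeight q r ^ (k + 1) / (k + 1)!)
  | 0, r, hr => by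
      rw [volterraIter_succ, volterraIter_zero, add_sub_cancel_left]
      have h1 := abs_setIntegral_kernel_mul_le (m := fun s => s) hI (B := fun _ => (1 : ℝ))
        continuousOn_const (fun s hs => by simp [abs_of_pos hs.1]) hr
      simp only [mul_one] at h1
      simpa [volterraWeight_eq] using h1
  | k + 1, r, hr => by
      rw [show k + 1 + 1 = k + 2 from rfl, volterraIter_succ_sub hI k hr]
      have hBc : ContinuousOn (fun s => volterraWeight q s ^ (k + 1) / (k + 1)!) (Icc 0 T) :=
        ((continuousOn_volterraWeight hI).pow _).div_const _
      have h1 := abs_setIntegral_kernel_mul_le (m := fun s => volterraIter q (k + 1) s - volterraIter q k s)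
        hI hBc (fun s hs => abs_volterraIter_succ_sub_le hI k (Ioc_subset_Icc_self hs)) hr
      have h2 : ∫ s in Ioc 0 r, s * |q s| * (volterraWeight q s ^ (k + 1) / (k + 1)!) =
          volterraWeight q r ^ (k + 2) / (k + 2)! := by
        have h3 := setIntegral_mul_primitive_pow hr.1 ((integrableOn_posPart_mul_abs hI).mono_set
          (Ioc_subset_Ioc_right hr.2)) (k + 1)
        have h4 : ∀ s ∈ Ioc 0 r, s * |q s| * (volterraWeight q s ^ (k + 1) / (k + 1)!) =
            ((k + 1)! : ℝ)⁻¹ * (max s 0 * |q s| * (∫ t in Ioc 0 s, max t 0 * |q t|) ^ (k + 1)) := by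
          intro s hs
          simp only [volterraWeight, max_eq_left hs.1.le]
          ring
        rw [setIntegral_congr_fun measurableSet_Ioc h4, integral_const_mul, h3, inv_factorial_mul_pow_div]
        rfl
      rw [h2] at h1
      exact h1

/-- The iterates as partial sums: `m_k = r + ∑_{j<k} (m_{j+1} - m_j)`. [folklore] -/
theorem volterraIter_eq_sum (q : ℝ → ℝ) (k : ℕ) (r : ℝ) :
    volterraIter q k r = r + ∑ j ∈ Finset.range k, (volterraIter q (j + 1) r - volterraIter q j r) := by
  rw [Finset.sum_range_sub (fun j => volterraIter q j r), volterraIter_zero]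
  ring

/-- The summable majorant `T G(T)^{k+1}/(k+1)!` of the increments on `[0, T]`. [folklore] -/
theorem summable_mul_pow_succ_div_factorial (x T : ℝ) : Summable fun k : ℕ => T * (x ^ (k + 1) / (k + 1)!) := by
  have h := (Real.summable_pow_div_factorial x).comp_injective (add_left_injective 1)
  exact (h.mul_left T).congr fun k => by simp [Function.comp]

/-- The uniform majorant `T G(T)^{k+1}/(k+1)!` of the increments on `[0, T]`. [folklore] -/
theorem abs_volterraIter_succ_sub_le_majorant (hI : IntegrableOn (fun s => s * q s) (Ioc 0 T))
    (k : ℕ) {r : ℝ} (hr : r ∈ Icc 0 T) :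
    |volterraIter q (k + 1) r - volterraIter q k r| ≤ T * (volterraWeight q T ^ (k + 1) / (k + 1)!) := by
  refine (abs_volterraIter_succ_sub_le hI k hr).trans ?_
  have h1 : volterraWeight q r ≤ volterraWeight q T := volterraWeight_mono hI hr.2 le_rfl
  have h2 := volterraWeight_nonneg q r
  have h3 : volterraWeight q r ^ (k + 1) / (k + 1)! ≤ volterraWeight q T ^ (k + 1) / (k + 1)! :=
    div_le_div_of_nonneg_right (pow_le_pow_left₀ h2 h1 _) (by positivity)
  exact mul_le_mul hr.2 h3 (by positivity) (hr.1.trans hr.2)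

/-- The increments are summable on `[0, T]`. [folklore] -/
theorem summable_volterraIter_sub (hI : IntegrableOn (fun s => s * q s) (Ioc 0 T)) {r : ℝ}
    (hr : r ∈ Icc 0 T) : Summable fun k => volterraIter q (k + 1) r - volterraIter q k r :=
  Summable.of_norm_bounded (summable_mul_pow_succ_div_factorial (volterraWeight q T) T) fun k => by
    rw [Real.norm_eq_abs]; exact abs_volterraIter_succ_sub_le_majorant hI k hr

/-- **The iteration converges** to `volterraSol` on `[0, T]`. [folklore] -/
theorem tendsto_volterraIter (hI : IntegrableOn (fun s => s * q s) (Ioc 0 T)) {r : ℝ}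
    (hr : r ∈ Icc 0 T) : Tendsto (fun k => volterraIter q k r) atTop (𝓝 (volterraSol q r)) := by
  have h := (summable_volterraIter_sub hI hr).hasSum.tendsto_sum_nat
  have h2 : (fun k => volterraIter q k r) = fun k => r + ∑ j ∈ Finset.range k,
      (volterraIter q (j + 1) r - volterraIter q j r) := funext fun k => volterraIter_eq_sum q k r
  rw [h2]
  exact tendsto_const_nhds.add h

/-- **The regular solution is continuous** on `[0, T]`. [folklore] -/
theorem continuousOn_volterraSol (hI : IntegrableOn (fun s => s * q s) (Ioc 0 T)) :
    ContinuousOn (volterraSol q) (Icc 0 T) := by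
  refine continuousOn_id.add ?_
  refine continuousOn_tsum (fun k => (continuousOn_volterraIter hI (k + 1)).sub
    (continuousOn_volterraIter hI k)) (summable_mul_pow_succ_div_factorial (volterraWeight q T) T) fun k r hr => ?_
  rw [Real.norm_eq_abs]
  exact abs_volterraIter_succ_sub_le_majorant hI k hr

/-- `m(0) = 0`. [folklore] -/
@[simp] theorem volterraSol_zero (q : ℝ → ℝ) : volterraSol q 0 = 0 := by
  simp [volterraSol, volterraIter_apply_zero]

/-- **A priori bound**: `|m(r)| ≤ r e^{G(r)}` on `[0, T]`. [cite: LSSY2005, (2.4)] -/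
theorem abs_volterraSol_le (hI : IntegrableOn (fun s => s * q s) (Ioc 0 T)) {r : ℝ} (hr : r ∈ Icc 0 T) :
    |volterraSol q r| ≤ r * Real.exp (volterraWeight q r) :=
  le_of_tendsto ((continuous_abs.tendsto _).comp (tendsto_volterraIter hI hr))
    (Eventually.of_forall fun k => abs_volterraIter_le hI k hr)

/-- The uniform linear-growth bound `|m(s)| ≤ e^{G(T)} s` on `[0, T]`. [folklore] -/
theorem abs_volterraSol_le_mul (hI : IntegrableOn (fun s => s * q s) (Ioc 0 T)) {s : ℝ}
    (hs : s ∈ Icc 0 T) : |volterraSol q s| ≤ Real.exp (volterraWeight q T) * s := by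
  refine (abs_volterraSol_le hI hs).trans ?_
  rw [mul_comm]
  exact mul_le_mul_of_nonneg_right (Real.exp_le_exp.2 (volterraWeight_mono hI hs.2 le_rfl)) hs.1

/-- **The Volterra equation** `m(r) = r + ∫₀ʳ (r - s) q(s) m(s) ds` on `[0, T]` (pass to the limit
in `m_{k+1} = r + ∫₀ʳ (r - s) q m_k` by dominated convergence). [cite: BoccatoEtAl2019, App. B, (B.1)] -/
theorem volterraSol_eq (hI : IntegrableOn (fun s => s * q s) (Ioc 0 T)) {r : ℝ} (hr : r ∈ Icc 0 T) :
    volterraSol q r = r + ∫ s in Ioc 0 r, (r - s) * q s * volterraSol q s := by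
  have hsub : Ioc 0 r ⊆ Ioc 0 T := Ioc_subset_Ioc_right hr.2
  set F : ℕ → ℝ → ℝ := fun k s => (r - s) * q s * volterraIter q k s with hF
  set f : ℝ → ℝ := fun s => (r - s) * q s * volterraSol q s with hf
  -- dominated convergence for `∫₀ʳ F_k → ∫₀ʳ f`
  have hlim : Tendsto (fun k => ∫ s in Ioc 0 r, F k s) atTop (𝓝 (∫ s in Ioc 0 r, f s)) := by
    refine tendsto_integral_of_dominated_convergence
      (fun s => r * (s * |q s|) * Real.exp (volterraWeight q T)) (fun k => ?_) ?_ (fun k => ?_) ?_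
    · exact (integrableOn_kernel_mul hI (continuousOn_volterraIter hI k)
        (fun s hs => abs_volterraIter_le_mul hI k hs) hr.2).aestronglyMeasurable
    · exact (((integrableOn_mul_abs hI).mono_set hsub).const_mul r).mul_const _
    · filter_upwards [ae_restrict_mem measurableSet_Ioc] with s hs
      have h1 := abs_volterraIter_le_mul hI k (Ioc_subset_Icc_self (hsub hs))
      rw [Real.norm_eq_abs, hF]
      simp only [abs_mul]
      have h2 : |r - s| ≤ r := by rw [abs_of_nonneg (by linarith [hs.2])]; linarith [hs.1]
      have h3 : 0 ≤ r * |q s| := mul_nonneg hr.1 (abs_nonneg _)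
      calc |r - s| * |q s| * |volterraIter q k s| ≤ r * |q s| * (Real.exp (volterraWeight q T) * s) := by
            gcongr
        _ = r * (s * |q s|) * Real.exp (volterraWeight q T) := by ring
    · filter_upwards [ae_restrict_mem measurableSet_Ioc] with s hs
      exact ((tendsto_volterraIter hI (Ioc_subset_Icc_self (hsub hs))).const_mul _)
  have hlim2 : Tendsto (fun k => volterraIter q (k + 1) r) atTop (𝓝 (r + ∫ s in Ioc 0 r, f s)) := by
    simp only [volterraIter_succ]
    exact tendsto_const_nhds.add hlim
  have hlim3 : Tendsto (fun k => volterraIter q (k + 1) r) atTop (𝓝 (volterraSol q r)) :=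
    (tendsto_volterraIter hI hr).comp (tendsto_add_atTop_nat 1)
  exact tendsto_nhds_unique hlim3 hlim2

/-- `q m` is integrable on `(0, T]`. [folklore] -/
theorem integrableOn_coeff_mul_volterraSol (hI : IntegrableOn (fun s => s * q s) (Ioc 0 T)) :
    IntegrableOn (fun s => q s * volterraSol q s) (Ioc 0 T) :=
  integrableOn_coeff_mul hI (continuousOn_volterraSol hI) fun _ hs => abs_volterraSol_le_mul hI hs

/-- `A(r) = ∫₀ʳ q m` is continuous on `[0, T]`. [folklore] -/
theorem continuousOn_volterraPrim (hI : IntegrableOn (fun s => s * q s) (Ioc 0 T)) :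
    ContinuousOn (volterraPrim q) (Icc 0 T) :=
  continuousOn_primitive_Ioc (integrableOn_coeff_mul_volterraSol hI)

/-- `m'` is continuous on `[0, T]`. [folklore] -/
theorem continuousOn_volterraDeriv (hI : IntegrableOn (fun s => s * q s) (Ioc 0 T)) :
    ContinuousOn (volterraDeriv q) (Icc 0 T) :=
  continuousOn_const.add (continuousOn_volterraPrim hI)

/-- `A(0) = 0`. [folklore] -/
@[simp] theorem volterraPrim_zero (q : ℝ → ℝ) : volterraPrim q 0 = 0 := by
  simp [volterraPrim]

/-- `m'(0) = 1`. [folklore] -/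
@[simp] theorem volterraDeriv_zero (q : ℝ → ℝ) : volterraDeriv q 0 = 1 := by
  simp [volterraDeriv]

/-- **The solution as a double primitive**: `m(r) = r + ∫₀ʳ A(s) ds`, `A(s) = ∫₀ˢ q m`
(Fubini on the triangle). [folklore] -/
theorem volterraSol_eq_integral_prim (hI : IntegrableOn (fun s => s * q s) (Ioc 0 T)) {r : ℝ}
    (hr : r ∈ Icc 0 T) : volterraSol q r = r + ∫ s in Ioc 0 r, volterraPrim q s := by
  have h1 := setIntegral_Ioc_primitive ((integrableOn_coeff_mul_volterraSol hI).mono_set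
    (Ioc_subset_Ioc_right hr.2))
  simp only [volterraPrim]
  rw [h1, volterraSol_eq hI hr]
  congr 1
  refine setIntegral_congr_fun measurableSet_Ioc fun s _ => ?_
  ring

/-- **`m` is `C¹` with `m' = 1 + A`** in the open interval `(0, T)`. [folklore] -/
theorem hasDerivAt_volterraSol (hI : IntegrableOn (fun s => s * q s) (Ioc 0 T)) {r : ℝ}
    (hr : r ∈ Ioo 0 T) : HasDerivAt (volterraSol q) (volterraDeriv q r) r := by
  have hrT : r ∈ Icc 0 T := Ioo_subset_Icc_self hr
  -- `m = r + ∫₀ʳ A` near `r`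
  have heq : (fun x => x + ∫ s in (0 : ℝ)..x, volterraPrim q s) =ᶠ[𝓝 r] volterraSol q := by
    filter_upwards [Ioo_mem_nhds hr.1 hr.2] with x hx
    rw [volterraSol_eq_integral_prim hI (Ioo_subset_Icc_self hx), intervalIntegral.integral_of_le hx.1.le]
  have hc : ContinuousOn (volterraPrim q) (Icc 0 T) := continuousOn_volterraPrim hI
  have hint : IntervalIntegrable (volterraPrim q) volume 0 r :=
    (hc.mono (Icc_subset_Icc_right hrT.2)).intervalIntegrable_of_Icc hrT.1
  have hmeas : StronglyMeasurableAtFilter (volterraPrim q) (𝓝 r) volume :=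
    (hc.mono Ioo_subset_Icc_self).stronglyMeasurableAtFilter isOpen_Ioo r hr
  have hcont : ContinuousAt (volterraPrim q) r := hc.continuousAt (Icc_mem_nhds hr.1 hr.2)
  have h1 := intervalIntegral.integral_hasDerivAt_right hint hmeas hcont
  have h2 := (hasDerivAt_id r).add h1
  exact h2.congr_of_eventuallyEq heq.symm

/-- **`r m'(r) - m(r) = ∫₀ʳ s q(s) m(s) ds`** (for `f = m/r`: `r² f'(r) = ∫₀ʳ s m''(s) ds`).
[cite: BoccatoEtAl2019, App. B (proof of Lemma 4.1 (iii))] -/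
theorem mul_volterraDeriv_sub_volterraSol (hI : IntegrableOn (fun s => s * q s) (Ioc 0 T)) {r : ℝ}
    (hr : r ∈ Icc 0 T) :
    r * volterraDeriv q r - volterraSol q r = ∫ s in Ioc 0 r, s * (q s * volterraSol q s) := by
  rw [volterraSol_eq hI hr, setIntegral_kernel_mul_eq hI (continuousOn_volterraSol hI)
    (fun s hs => abs_volterraSol_le_mul hI hs) hr.2]
  simp only [volterraDeriv, volterraPrim]
  ring

/-- **Restarting the equation at `R`**: for `0 ≤ R ≤ r ≤ T`,
`m(r) = m(R) + (r - R) m'(R) + ∫_R^r (r - s) q(s) m(s) ds`. [folklore] -/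
theorem volterraSol_restart (hI : IntegrableOn (fun s => s * q s) (Ioc 0 T)) {R r : ℝ} (hR : 0 ≤ R)
    (hRr : R ≤ r) (hr : r ≤ T) :
    volterraSol q r = volterraSol q R + (r - R) * volterraDeriv q R +
      ∫ s in Ioc R r, (r - s) * q s * volterraSol q s := by
  have hrT : r ∈ Icc 0 T := ⟨hR.trans hRr, hr⟩
  have hRT : R ∈ Icc 0 T := ⟨hR, hRr.trans hr⟩
  have hqi : IntegrableOn (fun s => q s * volterraSol q s) (Ioc 0 T) := integrableOn_coeff_mul_volterraSol hI
  have hPi : IntegrableOn (volterraPrim q) (Icc 0 T) :=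
    (continuousOn_volterraPrim hI).integrableOn_compact isCompact_Icc
  -- split `∫₀ʳ A = ∫₀ᴿ A + ∫_R^r A`
  have hsplit : ∫ s in Ioc 0 r, volterraPrim q s =
      (∫ s in Ioc 0 R, volterraPrim q s) + ∫ s in Ioc R r, volterraPrim q s := by
    rw [← setIntegral_union (Ioc_disjoint_Ioc_of_le le_rfl) measurableSet_Ioc
      (hPi.mono_set (Ioc_subset_Icc_self.trans (Icc_subset_Icc_right (hRr.trans hr))))
      (hPi.mono_set ((Ioc_subset_Ioc_left hR).trans (Ioc_subset_Icc_self.trans (Icc_subset_Icc_right hr)))),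
      Ioc_union_Ioc_eq_Ioc hR hRr]
  -- on `(R, r]`: `A(s) = A(R) + ∫_R^s q m`
  have hA : ∀ s ∈ Ioc R r, volterraPrim q s = volterraPrim q R + ∫ t in Ioc R s, q t * volterraSol q t := by
    intro s hs
    simp only [volterraPrim]
    rw [← setIntegral_union (Ioc_disjoint_Ioc_of_le le_rfl) measurableSet_Ioc
      (hqi.mono_set (Ioc_subset_Ioc_right (hRr.trans hr)))
      (hqi.mono_set ((Ioc_subset_Ioc_left hR).trans (Ioc_subset_Ioc_right (hs.2.trans hr)))),
      Ioc_union_Ioc_eq_Ioc hR hs.1.le]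
  have h2 : ∫ s in Ioc R r, volterraPrim q s =
      (r - R) * volterraPrim q R + ∫ t in Ioc R r, (r - t) * (q t * volterraSol q t) := by
    rw [setIntegral_congr_fun measurableSet_Ioc hA, integral_add, setIntegral_const,
      setIntegral_Ioc_primitive (hqi.mono_set ((Ioc_subset_Ioc_left hR).trans (Ioc_subset_Ioc_right hr)))]
    · simp only [smul_eq_mul, Real.volume_real_Ioc_of_le hRr]
    · exact integrableOn_const (by rw [Real.volume_Ioc]; exact ENNReal.ofReal_ne_top)
    · have h3 : IntegrableOn (fun s => volterraPrim q s - volterraPrim q R) (Ioc R r) :=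
        (hPi.mono_set ((Ioc_subset_Ioc_left hR).trans (Ioc_subset_Icc_self.trans (Icc_subset_Icc_right hr)))).sub
          (integrableOn_const (by rw [Real.volume_Ioc]; exact ENNReal.ofReal_ne_top))
      refine h3.congr ?_
      filter_upwards [ae_restrict_mem measurableSet_Ioc] with s hs
      rw [hA s hs]; ring
  rw [volterraSol_eq_integral_prim hI hrT, volterraSol_eq_integral_prim hI hRT, hsplit, h2]
  simp only [volterraDeriv]
  have h4 : ∫ t in Ioc R r, (r - t) * (q t * volterraSol q t) = ∫ s in Ioc R r, (r - s) * q s * volterraSol q s :=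
    setIntegral_congr_fun measurableSet_Ioc fun s _ => by ring
  rw [h4]
  ring

/-! ### Uniqueness and dependence on the coefficient -/

/-- **Uniqueness of the regular solution**: a continuous function on `[0, T]` with `|m(s)| ≤ C s`
satisfying the Volterra equation is `volterraSol q` (Grönwall with `δ = 0` for `|m - m̃|/r`).
[folklore] -/
theorem volterraSol_unique (hI : IntegrableOn (fun s => s * q s) (Ioc 0 T)) {m : ℝ → ℝ} {C : ℝ}
    (hmc : ContinuousOn m (Icc 0 T)) (hmb : ∀ s ∈ Icc 0 T, |m s| ≤ C * s)
    (heq : ∀ r ∈ Icc 0 T, m r = r + ∫ s in Ioc 0 r, (r - s) * q s * m s) :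
    ∀ r ∈ Icc 0 T, m r = volterraSol q r := by
  set h : ℝ → ℝ := fun r => m r - volterraSol q r with hh
  have hhc : ContinuousOn h (Icc 0 T) := hmc.sub (continuousOn_volterraSol hI)
  set C' : ℝ := max C 0 + Real.exp (volterraWeight q T) with hC'
  have hhb : ∀ s ∈ Icc 0 T, |h s| ≤ C' * s := fun s hs => by
    have h1 := hmb s hs
    have h2 := abs_volterraSol_le_mul hI hs
    have h3 : C * s ≤ max C 0 * s := mul_le_mul_of_nonneg_right (le_max_left _ _) hs.1
    calc |h s| ≤ |m s| + |volterraSol q s| := abs_sub _ _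
      _ ≤ C' * s := by rw [hC']; linarith
  -- `h` solves the homogeneous equation
  have hheq : ∀ r ∈ Icc 0 T, h r = ∫ s in Ioc 0 r, (r - s) * q s * h s := by
    intro r hr
    simp only [hh]
    rw [heq r hr, volterraSol_eq hI hr, add_sub_add_left_eq_sub, ← integral_sub
      (integrableOn_kernel_mul hI hmc hmb hr.2)
      (integrableOn_kernel_mul hI (continuousOn_volterraSol hI) (fun s hs => abs_volterraSol_le_mul hI hs) hr.2)]
    refine setIntegral_congr_fun measurableSet_Ioc fun s _ => ?_
    ring
  -- Grönwall for `ψ = |h|/r`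
  set ψ : ℝ → ℝ := fun r => |h r| / r with hψ
  have hψm : AEStronglyMeasurable ψ (volume.restrict (Ioc 0 T)) := by
    refine ContinuousOn.aestronglyMeasurable ?_ measurableSet_Ioc
    exact ((hhc.mono Ioc_subset_Icc_self).norm).div continuousOn_id fun s hs => hs.1.ne'
  have hψ0 : ∀ r ∈ Ioc 0 T, 0 ≤ ψ r := fun r hr => div_nonneg (abs_nonneg _) hr.1.le
  have hψB : ∀ r ∈ Ioc 0 T, ψ r ≤ C' := fun r hr => by
    rw [hψ, div_le_iff₀ hr.1]; exact hhb r (Ioc_subset_Icc_self hr)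
  have hψineq : ∀ r ∈ Ioc 0 T, ψ r ≤ 0 + ∫ s in Ioc 0 r, max s 0 * |q s| * ψ s := by
    intro r hr
    have hrT : r ∈ Icc 0 T := Ioc_subset_Icc_self hr
    have hBc : ContinuousOn (fun _ : ℝ => C') (Icc 0 T) := continuousOn_const
    -- `|h(r)| ≤ r ∫₀ʳ s|q| ψ`, with the majorant `B = ψ` handled through `|h s| ≤ s ψ(s)`
    have h1 : |∫ s in Ioc 0 r, (r - s) * q s * h s| ≤ ∫ s in Ioc 0 r, r * (max s 0 * |q s| * ψ s) := by
      rw [← Real.norm_eq_abs]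
      have hmaj : IntegrableOn (fun s => max s 0 * |q s| * ψ s) (Ioc 0 T) := by
        have h2 : IntegrableOn (fun s => ψ s * (max s 0 * |q s|)) (Ioc 0 T) := by
          refine Integrable.bdd_mul (c := C') (integrableOn_posPart_mul_abs hI) hψm ?_
          filter_upwards [ae_restrict_mem measurableSet_Ioc] with s hs
          rw [Real.norm_eq_abs, abs_of_nonneg (hψ0 s hs)]
          exact hψB s hs
        exact h2.congr (ae_of_all _ fun s => mul_comm _ _)
      refine norm_integral_le_of_norm_le ((hmaj.mono_set (Ioc_subset_Ioc_right hr.2)).const_mul r) ?_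
      filter_upwards [ae_restrict_mem measurableSet_Ioc] with s hs
      rw [Real.norm_eq_abs, abs_mul, abs_mul, max_eq_left hs.1.le]
      have h2 : |r - s| ≤ r := by rw [abs_of_nonneg (by linarith [hs.2])]; linarith [hs.1]
      have h3 : |h s| = s * ψ s := by rw [hψ]; field_simp [hs.1.ne']
      have h4 : 0 ≤ r * |q s| := mul_nonneg hrT.1 (abs_nonneg _)
      have h5 : 0 ≤ s * ψ s := mul_nonneg hs.1.le (hψ0 s ⟨hs.1, hs.2.trans hr.2⟩)
      calc |r - s| * |q s| * |h s| ≤ r * |q s| * (s * ψ s) := by rw [h3]; gcongr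
        _ = r * (s * |q s| * ψ s) := by ring
    rw [integral_const_mul, ← hheq r hrT] at h1
    rw [zero_add, hψ]
    simp only
    rw [div_le_iff₀ hr.1, mul_comm]
    exact h1
  have hG := gronwall_volterra (integrableOn_posPart_mul_abs hI) (posPart_mul_abs_nonneg q) hψm hψ0 hψB le_rfl hψineq
  intro r hr
  rcases hr.1.eq_or_lt with h0 | h0
  · rw [← h0, volterraSol_zero]
    have := heq 0 (by rw [← h0] at hr; exact ⟨le_rfl, hr.2⟩)
    simpa using this
  · have h1 := hG r ⟨h0, hr.2⟩
    rw [zero_mul] at h1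
    have h2 : ψ r = 0 := le_antisymm h1 (hψ0 r ⟨h0, hr.2⟩)
    rw [hψ] at h2
    simp only [div_eq_zero_iff, abs_eq_zero, h0.ne', or_false] at h2
    simp only [hh] at h2
    linarith

section Dependence

variable {q₁ q₂ : ℝ → ℝ}

/-- **Lipschitz dependence on the coefficient.** For two coefficients with
`∫₀ᵀ s|qᵢ| < ∞` and `δ = ∫₀ᵀ s|q₁ - q₂| ds`:
`|m₁(r) - m₂(r)| ≤ e^{G₂(T)} δ · r e^{G₁(r)}` on `[0, T]`. (The difference solves
`h = ∫₀ʳ (r-s)[q₁ h + (q₁ - q₂) m₂]`; Grönwall for `|h|/r`.) [folklore] -/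
theorem abs_volterraSol_sub_volterraSol_le (hI₁ : IntegrableOn (fun s => s * q₁ s) (Ioc 0 T))
    (hI₂ : IntegrableOn (fun s => s * q₂ s) (Ioc 0 T)) {r : ℝ} (hr : r ∈ Icc 0 T) :
    |volterraSol q₁ r - volterraSol q₂ r| ≤
      Real.exp (volterraWeight q₂ T) * (∫ s in Ioc 0 T, s * |q₁ s - q₂ s|) *
        (r * Real.exp (volterraWeight q₁ r)) := by
  have hI12 : IntegrableOn (fun s => s * (q₁ s - q₂ s)) (Ioc 0 T) :=
    (hI₁.sub hI₂).congr (ae_of_all _ fun s => by simp only [Pi.sub_apply]; ring)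
  set δ : ℝ := Real.exp (volterraWeight q₂ T) * ∫ s in Ioc 0 T, s * |q₁ s - q₂ s| with hδ
  have hδ0 : 0 ≤ δ := mul_nonneg (Real.exp_nonneg _)
    (setIntegral_nonneg measurableSet_Ioc fun s hs => mul_nonneg hs.1.le (abs_nonneg _))
  set h : ℝ → ℝ := fun r => volterraSol q₁ r - volterraSol q₂ r with hh
  have hc₁ := continuousOn_volterraSol hI₁
  have hc₂ := continuousOn_volterraSol hI₂
  have hb₁ : ∀ s ∈ Icc 0 T, |volterraSol q₁ s| ≤ Real.exp (volterraWeight q₁ T) * s :=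
    fun s hs => abs_volterraSol_le_mul hI₁ hs
  have hb₂ : ∀ s ∈ Icc 0 T, |volterraSol q₂ s| ≤ Real.exp (volterraWeight q₂ T) * s :=
    fun s hs => abs_volterraSol_le_mul hI₂ hs
  have hhc : ContinuousOn h (Icc 0 T) := hc₁.sub hc₂
  -- the equation for the difference
  have hheq : ∀ r ∈ Icc 0 T, h r = (∫ s in Ioc 0 r, (r - s) * q₁ s * h s) +
      ∫ s in Ioc 0 r, (r - s) * (q₁ s - q₂ s) * volterraSol q₂ s := by
    intro r hr
    have hb12 : ∀ s ∈ Icc 0 T, |h s| ≤ (Real.exp (volterraWeight q₁ T) + Real.exp (volterraWeight q₂ T)) * s :=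
      fun s hs => by
        calc |h s| ≤ |volterraSol q₁ s| + |volterraSol q₂ s| := abs_sub _ _
          _ ≤ _ := by rw [add_mul]; exact add_le_add (hb₁ s hs) (hb₂ s hs)
    simp only [hh]
    rw [volterraSol_eq hI₁ hr, volterraSol_eq hI₂ hr, add_sub_add_left_eq_sub,
      ← integral_sub (integrableOn_kernel_mul hI₁ hc₁ hb₁ hr.2) (integrableOn_kernel_mul hI₂ hc₂ hb₂ hr.2),
      ← integral_add (integrableOn_kernel_mul hI₁ hhc hb12 hr.2) (integrableOn_kernel_mul hI12 hc₂ hb₂ hr.2)]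
    refine setIntegral_congr_fun measurableSet_Ioc fun s _ => ?_
    ring
  -- the forcing term is at most `δ r`
  have hforce : ∀ r ∈ Icc 0 T, |∫ s in Ioc 0 r, (r - s) * (q₁ s - q₂ s) * volterraSol q₂ s| ≤ δ * r := by
    intro r hr
    have h1 := abs_setIntegral_kernel_mul_le (q := fun s => q₁ s - q₂ s) (m := volterraSol q₂) hI12
      (B := fun _ => Real.exp (volterraWeight q₂ T)) continuousOn_const
      (fun s hs => by rw [mul_comm]; exact hb₂ s (Ioc_subset_Icc_self hs)) hr
    refine h1.trans ?_
    rw [integral_mul_const]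
    have h2 : ∫ s in Ioc 0 r, s * |q₁ s - q₂ s| ≤ ∫ s in Ioc 0 T, s * |q₁ s - q₂ s| :=
      setIntegral_mono_set (integrableOn_mul_abs hI12)
        (by filter_upwards [ae_restrict_mem measurableSet_Ioc] with s hs; exact mul_nonneg hs.1.le (abs_nonneg _))
        (ae_of_all _ (Ioc_subset_Ioc_right hr.2))
    have h3 := Real.exp_nonneg (volterraWeight q₂ T)
    calc r * ((∫ s in Ioc 0 r, s * |q₁ s - q₂ s|) * Real.exp (volterraWeight q₂ T))
        ≤ r * ((∫ s in Ioc 0 T, s * |q₁ s - q₂ s|) * Real.exp (volterraWeight q₂ T)) := by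
          exact mul_le_mul_of_nonneg_left (mul_le_mul_of_nonneg_right h2 h3) hr.1
      _ = δ * r := by rw [hδ]; ring
  -- Grönwall for `ψ = |h|/r`
  set C' : ℝ := Real.exp (volterraWeight q₁ T) + Real.exp (volterraWeight q₂ T) with hC'
  set ψ : ℝ → ℝ := fun r => |h r| / r with hψ
  have hψm : AEStronglyMeasurable ψ (volume.restrict (Ioc 0 T)) := by
    refine ContinuousOn.aestronglyMeasurable ?_ measurableSet_Ioc
    exact ((hhc.mono Ioc_subset_Icc_self).norm).div continuousOn_id fun s hs => hs.1.ne'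
  have hψ0 : ∀ r ∈ Ioc 0 T, 0 ≤ ψ r := fun r hr => div_nonneg (abs_nonneg _) hr.1.le
  have hψB : ∀ r ∈ Ioc 0 T, ψ r ≤ C' := fun r hr => by
    rw [hψ, div_le_iff₀ hr.1]
    calc |h r| ≤ |volterraSol q₁ r| + |volterraSol q₂ r| := abs_sub _ _
      _ ≤ C' * r := by
        rw [hC', add_mul]
        exact add_le_add (hb₁ r (Ioc_subset_Icc_self hr)) (hb₂ r (Ioc_subset_Icc_self hr))
  have hψineq : ∀ r ∈ Ioc 0 T, ψ r ≤ δ + ∫ s in Ioc 0 r, max s 0 * |q₁ s| * ψ s := by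
    intro r hr
    have hrT : r ∈ Icc 0 T := Ioc_subset_Icc_self hr
    have h1 : |∫ s in Ioc 0 r, (r - s) * q₁ s * h s| ≤ ∫ s in Ioc 0 r, r * (max s 0 * |q₁ s| * ψ s) := by
      rw [← Real.norm_eq_abs]
      have hmaj : IntegrableOn (fun s => max s 0 * |q₁ s| * ψ s) (Ioc 0 T) := by
        have h2 : IntegrableOn (fun s => ψ s * (max s 0 * |q₁ s|)) (Ioc 0 T) := by
          refine Integrable.bdd_mul (c := C') (integrableOn_posPart_mul_abs hI₁) hψm ?_
          filter_upwards [ae_restrict_mem measurableSet_Ioc] with s hs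
          rw [Real.norm_eq_abs, abs_of_nonneg (hψ0 s hs)]
          exact hψB s hs
        exact h2.congr (ae_of_all _ fun s => mul_comm _ _)
      refine norm_integral_le_of_norm_le ((hmaj.mono_set (Ioc_subset_Ioc_right hr.2)).const_mul r) ?_
      filter_upwards [ae_restrict_mem measurableSet_Ioc] with s hs
      rw [Real.norm_eq_abs, abs_mul, abs_mul, max_eq_left hs.1.le]
      have h2 : |r - s| ≤ r := by rw [abs_of_nonneg (by linarith [hs.2])]; linarith [hs.1]
      have h3 : |h s| = s * ψ s := by rw [hψ]; field_simp [hs.1.ne']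
      have h4 : 0 ≤ r * |q₁ s| := mul_nonneg hrT.1 (abs_nonneg _)
      have h5 : 0 ≤ s * ψ s := mul_nonneg hs.1.le (hψ0 s ⟨hs.1, hs.2.trans hr.2⟩)
      calc |r - s| * |q₁ s| * |h s| ≤ r * |q₁ s| * (s * ψ s) := by rw [h3]; gcongr
        _ = r * (s * |q₁ s| * ψ s) := by ring
    rw [integral_const_mul] at h1
    have h5 : |h r| ≤ r * (∫ s in Ioc 0 r, max s 0 * |q₁ s| * ψ s) + δ * r := by
      rw [hheq r hrT]
      exact (abs_add_le _ _).trans (add_le_add h1 (hforce r hrT))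
    rw [hψ]
    simp only
    rw [div_le_iff₀ hr.1]
    nlinarith [h5]
  have hG := gronwall_volterra (integrableOn_posPart_mul_abs hI₁) (posPart_mul_abs_nonneg q₁) hψm hψ0 hψB hδ0 hψineq
  rcases hr.1.eq_or_lt with h0 | h0
  · rw [← h0]; simp
  · have h1 := hG r ⟨h0, hr.2⟩
    rw [hψ] at h1
    simp only at h1
    rw [div_le_iff₀ h0] at h1
    simp only [hh] at h1
    calc |volterraSol q₁ r - volterraSol q₂ r| ≤ δ * Real.exp (volterraWeight q₁ r) * r := h1
      _ = _ := by rw [hδ]; ring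

/-- **Lipschitz dependence of the derivative on the coefficient**:
`|m₁'(r) - m₂'(r)| ≤ e^{G₂(T)} δ (1 + G₁(T) e^{G₁(T)})`, `δ = ∫₀ᵀ s|q₁ - q₂| ds`. [folklore] -/
theorem abs_volterraDeriv_sub_volterraDeriv_le (hI₁ : IntegrableOn (fun s => s * q₁ s) (Ioc 0 T))
    (hI₂ : IntegrableOn (fun s => s * q₂ s) (Ioc 0 T)) {r : ℝ} (hr : r ∈ Icc 0 T) :
    |volterraDeriv q₁ r - volterraDeriv q₂ r| ≤
      Real.exp (volterraWeight q₂ T) * (∫ s in Ioc 0 T, s * |q₁ s - q₂ s|) *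
        (1 + volterraWeight q₁ T * Real.exp (volterraWeight q₁ T)) := by
  have hI12 : IntegrableOn (fun s => s * (q₁ s - q₂ s)) (Ioc 0 T) :=
    (hI₁.sub hI₂).congr (ae_of_all _ fun s => by simp only [Pi.sub_apply]; ring)
  set δ : ℝ := Real.exp (volterraWeight q₂ T) * ∫ s in Ioc 0 T, s * |q₁ s - q₂ s| with hδ
  have hδ0 : 0 ≤ δ := mul_nonneg (Real.exp_nonneg _)
    (setIntegral_nonneg measurableSet_Ioc fun s hs => mul_nonneg hs.1.le (abs_nonneg _))
  have hsub : Ioc 0 r ⊆ Ioc 0 T := Ioc_subset_Ioc_right hr.2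
  have hc₁ := continuousOn_volterraSol hI₁
  have hc₂ := continuousOn_volterraSol hI₂
  have hb₁ : ∀ s ∈ Icc 0 T, |volterraSol q₁ s| ≤ Real.exp (volterraWeight q₁ T) * s :=
    fun s hs => abs_volterraSol_le_mul hI₁ hs
  have hb₂ : ∀ s ∈ Icc 0 T, |volterraSol q₂ s| ≤ Real.exp (volterraWeight q₂ T) * s :=
    fun s hs => abs_volterraSol_le_mul hI₂ hs
  have hhc : ContinuousOn (fun s => volterraSol q₁ s - volterraSol q₂ s) (Icc 0 T) := hc₁.sub hc₂
  have hb12 : ∀ s ∈ Icc 0 T, |volterraSol q₁ s - volterraSol q₂ s| ≤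
      (Real.exp (volterraWeight q₁ T) + Real.exp (volterraWeight q₂ T)) * s := fun s hs => by
    calc |volterraSol q₁ s - volterraSol q₂ s| ≤ |volterraSol q₁ s| + |volterraSol q₂ s| := abs_sub _ _
      _ ≤ _ := by rw [add_mul]; exact add_le_add (hb₁ s hs) (hb₂ s hs)
  have hi1 : IntegrableOn (fun s => q₁ s * (volterraSol q₁ s - volterraSol q₂ s)) (Ioc 0 T) :=
    integrableOn_coeff_mul hI₁ hhc hb12
  have hi2 : IntegrableOn (fun s => (q₁ s - q₂ s) * volterraSol q₂ s) (Ioc 0 T) :=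
    integrableOn_coeff_mul hI12 hc₂ hb₂
  have hsplit : volterraDeriv q₁ r - volterraDeriv q₂ r =
      (∫ s in Ioc 0 r, q₁ s * (volterraSol q₁ s - volterraSol q₂ s)) +
        ∫ s in Ioc 0 r, (q₁ s - q₂ s) * volterraSol q₂ s := by
    simp only [volterraDeriv, volterraPrim]
    rw [add_sub_add_left_eq_sub, ← integral_sub ((integrableOn_coeff_mul_volterraSol hI₁).mono_set hsub)
      ((integrableOn_coeff_mul_volterraSol hI₂).mono_set hsub), ← integral_add (hi1.mono_set hsub) (hi2.mono_set hsub)]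
    refine setIntegral_congr_fun measurableSet_Ioc fun s _ => ?_
    ring
  -- first term: `∫ |q₁| |h| ≤ ∫ s|q₁| · δ e^{G₁ T} ≤ G₁(T) δ e^{G₁(T)}`
  have h1 : |∫ s in Ioc 0 r, q₁ s * (volterraSol q₁ s - volterraSol q₂ s)| ≤
      ∫ s in Ioc 0 r, max s 0 * |q₁ s| * (δ * Real.exp (volterraWeight q₁ T)) := by
    rw [← Real.norm_eq_abs]
    refine norm_integral_le_of_norm_le (((integrableOn_posPart_mul_abs hI₁).mono_set hsub).mul_const _) ?_
    filter_upwards [ae_restrict_mem measurableSet_Ioc] with s hs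
    have hsT : s ∈ Icc 0 T := Ioc_subset_Icc_self (hsub hs)
    have h2 := abs_volterraSol_sub_volterraSol_le hI₁ hI₂ hsT
    rw [Real.norm_eq_abs, abs_mul, max_eq_left hs.1.le]
    have h3 : Real.exp (volterraWeight q₁ s) ≤ Real.exp (volterraWeight q₁ T) :=
      Real.exp_le_exp.2 (volterraWeight_mono hI₁ hsT.2 le_rfl)
    have h4 : |volterraSol q₁ s - volterraSol q₂ s| ≤ δ * (s * Real.exp (volterraWeight q₁ T)) := by
      refine h2.trans ?_
      rw [← hδ]
      exact mul_le_mul_of_nonneg_left (mul_le_mul_of_nonneg_left h3 hs.1.le) hδ0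
    calc |q₁ s| * |volterraSol q₁ s - volterraSol q₂ s| ≤ |q₁ s| * (δ * (s * Real.exp (volterraWeight q₁ T))) :=
          mul_le_mul_of_nonneg_left h4 (abs_nonneg _)
      _ = s * |q₁ s| * (δ * Real.exp (volterraWeight q₁ T)) := by ring
  rw [integral_mul_const] at h1
  have h1' : ∫ s in Ioc 0 r, max s 0 * |q₁ s| ≤ volterraWeight q₁ T := volterraWeight_mono hI₁ hr.2 le_rfl
  -- second term: `≤ δ`
  have h2 : |∫ s in Ioc 0 r, (q₁ s - q₂ s) * volterraSol q₂ s| ≤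
      ∫ s in Ioc 0 r, s * |q₁ s - q₂ s| * Real.exp (volterraWeight q₂ T) := by
    rw [← Real.norm_eq_abs]
    refine norm_integral_le_of_norm_le (((integrableOn_mul_abs hI12).mono_set hsub).mul_const _) ?_
    filter_upwards [ae_restrict_mem measurableSet_Ioc] with s hs
    have hsT : s ∈ Icc 0 T := Ioc_subset_Icc_self (hsub hs)
    rw [Real.norm_eq_abs, abs_mul]
    calc |q₁ s - q₂ s| * |volterraSol q₂ s| ≤ |q₁ s - q₂ s| * (Real.exp (volterraWeight q₂ T) * s) :=
          mul_le_mul_of_nonneg_left (hb₂ s hsT) (abs_nonneg _)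
      _ = s * |q₁ s - q₂ s| * Real.exp (volterraWeight q₂ T) := by ring
  rw [integral_mul_const] at h2
  have h2' : ∫ s in Ioc 0 r, s * |q₁ s - q₂ s| ≤ ∫ s in Ioc 0 T, s * |q₁ s - q₂ s| :=
    setIntegral_mono_set (integrableOn_mul_abs hI12)
      (by filter_upwards [ae_restrict_mem measurableSet_Ioc] with s hs; exact mul_nonneg hs.1.le (abs_nonneg _))
      (ae_of_all _ hsub)
  have hW0 := volterraWeight_nonneg q₁ T
  have hE1 := Real.exp_nonneg (volterraWeight q₁ T)
  have hE2 := Real.exp_nonneg (volterraWeight q₂ T)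
  have hJ0 : 0 ≤ ∫ s in Ioc 0 T, s * |q₁ s - q₂ s| :=
    setIntegral_nonneg measurableSet_Ioc fun s hs => mul_nonneg hs.1.le (abs_nonneg _)
  rw [hsplit]
  calc |(∫ s in Ioc 0 r, q₁ s * (volterraSol q₁ s - volterraSol q₂ s)) +
        ∫ s in Ioc 0 r, (q₁ s - q₂ s) * volterraSol q₂ s|
      ≤ (∫ s in Ioc 0 r, max s 0 * |q₁ s|) * (δ * Real.exp (volterraWeight q₁ T)) +
        (∫ s in Ioc 0 r, s * |q₁ s - q₂ s|) * Real.exp (volterraWeight q₂ T) :=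
        (abs_add_le _ _).trans (add_le_add h1 h2)
    _ ≤ volterraWeight q₁ T * (δ * Real.exp (volterraWeight q₁ T)) +
        (∫ s in Ioc 0 T, s * |q₁ s - q₂ s|) * Real.exp (volterraWeight q₂ T) := by
        gcongr
    _ = _ := by rw [hδ]; ring

end Dependence

/-! ### Non-negative coefficients -/

/-- For `q ≥ 0` the iterates dominate `r`: `m_k(r) ≥ r` on `[0, T]`. [cite: LSSY2005, (2.4)] -/
theorem le_volterraIter (hI : IntegrableOn (fun s => s * q s) (Ioc 0 T)) (hq0 : ∀ s, 0 ≤ q s) :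
    ∀ (k : ℕ) {r : ℝ}, r ∈ Icc 0 T → r ≤ volterraIter q k r
  | 0, r, _ => le_rfl
  | k + 1, r, hr => by
      rw [volterraIter_succ]
      refine le_add_of_nonneg_right (setIntegral_nonneg measurableSet_Ioc fun s hs => ?_)
      have h1 : 0 ≤ volterraIter q k s :=
        hs.1.le.trans (le_volterraIter hI hq0 k (Ioc_subset_Icc_self (Ioc_subset_Ioc_right hr.2 hs)))
      exact mul_nonneg (mul_nonneg (by linarith [hs.2]) (hq0 s)) h1

/-- For `q ≥ 0`: `m(r) ≥ r` on `[0, T]`. [cite: LSSY2005, (2.4)] -/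
theorem le_volterraSol (hI : IntegrableOn (fun s => s * q s) (Ioc 0 T)) (hq0 : ∀ s, 0 ≤ q s) {r : ℝ}
    (hr : r ∈ Icc 0 T) : r ≤ volterraSol q r :=
  ge_of_tendsto' (tendsto_volterraIter hI hr) fun k => le_volterraIter hI hq0 k hr

/-- For `q ≥ 0`: `m ≥ 0` on `[0, T]`. [cite: LSSY2005, (2.4)] -/
theorem volterraSol_nonneg (hI : IntegrableOn (fun s => s * q s) (Ioc 0 T)) (hq0 : ∀ s, 0 ≤ q s) {r : ℝ}
    (hr : r ∈ Icc 0 T) : 0 ≤ volterraSol q r :=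
  hr.1.trans (le_volterraSol hI hq0 hr)

/-- For `q ≥ 0`: `A(r) = ∫₀ʳ q m ≥ 0`, i.e. `m'(r) ≥ 1`, on `[0, T]`. [cite: LSSY2005, (2.4)] -/
theorem volterraPrim_nonneg (hI : IntegrableOn (fun s => s * q s) (Ioc 0 T)) (hq0 : ∀ s, 0 ≤ q s)
    {r : ℝ} (hr : r ∈ Icc 0 T) : 0 ≤ volterraPrim q r :=
  setIntegral_nonneg measurableSet_Ioc fun s hs =>
    mul_nonneg (hq0 s) (volterraSol_nonneg hI hq0 (Ioc_subset_Icc_self (Ioc_subset_Ioc_right hr.2 hs)))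

/-- For `q ≥ 0`: `m' ≥ 1` on `[0, T]`. [cite: LSSY2005, (2.4)] -/
theorem one_le_volterraDeriv (hI : IntegrableOn (fun s => s * q s) (Ioc 0 T)) (hq0 : ∀ s, 0 ≤ q s)
    {r : ℝ} (hr : r ∈ Icc 0 T) : 1 ≤ volterraDeriv q r :=
  le_add_of_nonneg_right (volterraPrim_nonneg hI hq0 hr)

/-- For `q ≥ 0`, `A` is monotone on `[0, T]`. [cite: LSSY2005, (2.4)] -/
theorem volterraPrim_mono (hI : IntegrableOn (fun s => s * q s) (Ioc 0 T)) (hq0 : ∀ s, 0 ≤ q s)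
    {s₁ s₂ : ℝ} (h12 : s₁ ≤ s₂) (h2 : s₂ ≤ T) : volterraPrim q s₁ ≤ volterraPrim q s₂ :=
  setIntegral_mono_set ((integrableOn_coeff_mul_volterraSol hI).mono_set (Ioc_subset_Ioc_right h2))
    (by
      filter_upwards [ae_restrict_mem measurableSet_Ioc] with s hs
      exact mul_nonneg (hq0 s) (volterraSol_nonneg hI hq0 ⟨hs.1.le, hs.2.trans h2⟩))
    (ae_of_all _ (Ioc_subset_Ioc_right h12))

/-- For `q ≥ 0`: `m(r) ≤ r m'(r)` on `[0, T]` (`r m' - m = ∫₀ʳ s q m ≥ 0`). [cite: LSSY2005, (2.4)] -/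
theorem volterraSol_le_mul_volterraDeriv (hI : IntegrableOn (fun s => s * q s) (Ioc 0 T))
    (hq0 : ∀ s, 0 ≤ q s) {r : ℝ} (hr : r ∈ Icc 0 T) : volterraSol q r ≤ r * volterraDeriv q r := by
  have h := mul_volterraDeriv_sub_volterraSol hI hr
  have h2 : 0 ≤ ∫ s in Ioc 0 r, s * (q s * volterraSol q s) :=
    setIntegral_nonneg measurableSet_Ioc fun s hs => mul_nonneg hs.1.le
      (mul_nonneg (hq0 s) (volterraSol_nonneg hI hq0 (Ioc_subset_Icc_self (Ioc_subset_Ioc_right hr.2 hs))))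
  linarith

/-! ### Bounded potentials: agreement with the tree's monotone construction `radialSol` -/

section Bounded

variable {w : ℝ → ℝ≥0∞} {M : ℝ}

/-- A bounded coefficient has `∫₀ᵀ s|q| < ∞`. [folklore] -/
theorem integrableOn_id_mul_of_bounded {q : ℝ → ℝ} (hq : Measurable q) {K : ℝ} (hK : ∀ s, |q s| ≤ K)
    (T : ℝ) : IntegrableOn (fun s => s * q s) (Ioc 0 T) := by
  have h1 : IntegrableOn (fun s : ℝ => s) (Ioc 0 T) :=
    (continuous_id.integrableOn_Icc (a := 0) (b := T)).mono_set Ioc_subset_Icc_self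
  refine Integrable.mul_bdd (c := K) h1 hq.aestronglyMeasurable (ae_of_all _ fun s => ?_)
  rw [Real.norm_eq_abs]; exact hK s

/-- The coefficient `q = ½w` of a bounded measurable potential `w ≤ M`. [folklore] -/
theorem integrableOn_id_mul_halfPot (hw : Measurable w) (hM : ∀ r, w r ≤ ENNReal.ofReal M) (hM0 : 0 ≤ M)
    (T : ℝ) : IntegrableOn (fun s => s * ((w s).toReal / 2)) (Ioc 0 T) := by
  refine integrableOn_id_mul_of_bounded (hw.ennreal_toReal.div_const 2) (K := M / 2) (fun s => ?_) T
  rw [abs_of_nonneg (by positivity)]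
  exact div_le_div_of_nonneg_right (toReal_pot_le hM hM0 s) (by norm_num)

/-- **For a bounded potential `q = ½w`, `volterraSol` is the tree's `radialSol w`** (both solve
the Volterra equation, `radialSol` is continuous with `0 ≤ u(r) ≤ r e^{Mr²/4}`; uniqueness).
[cite: LSSY2005, (2.4)–(2.5)] -/
theorem volterraSol_eq_radialSol (hw : Measurable w) (hM : ∀ r, w r ≤ ENNReal.ofReal M) (hM0 : 0 ≤ M)
    {r : ℝ} (hr : 0 ≤ r) : volterraSol (fun s => (w s).toReal / 2) r = radialSol w r := by
  set T := r
  have hI := integrableOn_id_mul_halfPot hw hM hM0 T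
  have hmc : ContinuousOn (radialSol w) (Icc 0 T) := by
    intro s hs
    rcases hs.1.eq_or_lt with h0 | h0
    · -- continuity at `0` from `0 ≤ u(x) ≤ x e^{Mx²/4} ≤ x e^{MT²/4}`
      rw [← h0, ContinuousWithinAt, radialSol_of_nonpos w le_rfl]
      have hle : ∀ x ∈ Icc 0 T, radialSol w x ≤ x * Real.exp (M * T ^ 2 / 4) := fun x hx =>
        (radialSol_le_exp hw hM hM0 hx.1).trans
          (mul_le_mul_of_nonneg_left (Real.exp_le_exp.2 (by gcongr <;> linarith [hx.1, hx.2])) hx.1)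
      have h1 : Tendsto (fun x : ℝ => x * Real.exp (M * T ^ 2 / 4)) (𝓝 0) (𝓝 0) := by
        have hc : Continuous fun x : ℝ => x * Real.exp (M * T ^ 2 / 4) := by fun_prop
        simpa using hc.tendsto 0
      exact squeeze_zero' (eventually_nhdsWithin_of_forall fun x _ => radialSol_nonneg w x)
        (eventually_nhdsWithin_of_forall hle) (h1.mono_left nhdsWithin_le_nhds)
    · exact (continuousAt_radialSol hw hM hM0 h0).continuousWithinAt
  have hmb : ∀ s ∈ Icc 0 T, |radialSol w s| ≤ Real.exp (M * T ^ 2 / 4) * s := by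
    intro s hs
    rw [abs_of_nonneg (radialSol_nonneg w s), mul_comm]
    refine (radialSol_le_exp hw hM hM0 hs.1).trans (mul_le_mul_of_nonneg_left ?_ hs.1)
    exact Real.exp_le_exp.2 (by gcongr <;> linarith [hs.1, hs.2])
  have heq : ∀ s ∈ Icc 0 T, radialSol w s = s + ∫ t in Ioc 0 s, (s - t) * ((w t).toReal / 2) * radialSol w t :=
    fun s hs => radialSol_eq hw hM hM0 hs.1
  exact (volterraSol_unique hI hmc hmb heq r ⟨hr, le_rfl⟩).symm

/-- For a bounded potential, `volterraDeriv` is the tree's `radialSolDeriv w`. [cite: LSSY2005, (2.4)–(2.5)] -/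
theorem volterraDeriv_eq_radialSolDeriv (hw : Measurable w) (hM : ∀ r, w r ≤ ENNReal.ofReal M) (hM0 : 0 ≤ M)
    (r : ℝ) : volterraDeriv (fun s => (w s).toReal / 2) r = radialSolDeriv w r := by
  rw [radialSolDeriv_eq hw hM hM0]
  simp only [volterraDeriv, volterraPrim]
  congr 1
  refine setIntegral_congr_fun measurableSet_Ioc fun s hs => ?_
  rw [volterraSol_eq_radialSol hw hM hM0 hs.1.le]

/-- For a bounded potential, the ODE scattering length of the tree is read off from `volterraSol`:
`a = R - m(R)/m'(R)`. [cite: LSSY2005, (2.5)] -/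
theorem odeScatteringLength_eq_volterra (hw : Measurable w) (hM : ∀ r, w r ≤ ENNReal.ofReal M) (hM0 : 0 ≤ M)
    {R : ℝ} (hR : 0 ≤ R) :
    odeScatteringLength w R = R - volterraSol (fun s => (w s).toReal / 2) R /
      volterraDeriv (fun s => (w s).toReal / 2) R := by
  rw [volterraSol_eq_radialSol hw hM hM0 hR, volterraDeriv_eq_radialSolDeriv hw hM hM0]
  rfl

end Bounded

end Volterra


end Literature.MathematicalPhysics.QuantumManyBody.BoseGas
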